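import Mathlib
import Summits.Langlands.Langlands.Theses.QuadraticWindow
import Summits.Langlands.Langlands.Theorems.TwistUnpackaging.Negative.TwistSeparationOrder
import Summits.Langlands.Langlands.Theorems.TwistUnpackaging.Negative.ControlLoadBearing
import Literature.NumberTheory.GaloisRepresentations.AbsGaloisOuterConj
import Literature.NumberTheory.GaloisRepresentations.SatakeFamilyOfFramedGaloisRep
import Literature.NumberTheory.GaloisRepresentations.HeckeCharacterGaloisAvatarProofs
import Literature.NumberTheory.GaloisRepresentations.HeckeCharacterOfRayClass
import Literature.NumberTheory.GaloisRepresentations.FramedRepTwist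
import Literature.NumberTheory.Automorphic.SelfdualGL3AdjointLiftProofs
import Literature.NumberTheory.Automorphic.AutomorphicRepsGLSatakeFlathProofs
import Literature.NumberTheory.Automorphic.ChebotarevArtinRepHolds
import Summits.Langlands.Langlands.Theorems.QuadraticWindowTwistUnpackagingRayClassTwist
import Summits.Langlands.Langlands.Theorems.QuadraticWindowTwistUnpackagingAvatarPowers
import Summits.Langlands.Langlands.Theorems.QuadraticWindowTwistUnpackagingAdmissiblePowers
import Summits.Langlands.Langlands.Theorems.QuadraticWindowTwistUnpackagingPackageDictionary
import Summits.Langlands.Langlands.Theorems.QuadraticWindowTwistUnpackagingFiniteCandidateGluing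
import Summits.Langlands.Langlands.Theorems.QuadraticWindowTwistUnpackagingAssembly

/-!
# Line `kummer-chebotarev-separating-twists` — checked skeleton for the crux
`Summit.Langlands.Langlands.Theses.QuadraticWindow.TwistUnpackaging` (stmt-Langlands-10903)

Planner crux-plan (round 1), RESHAPED by the line lead (2026-08-16): seven registered stubs
`stub_*` (sorried, each a genuine lemma of the line) and the kernel-checked composition
`TwistUnpackaging_of : TwistUnpackaging` (no sorry outside the stubs). See
`Lines/kummer-chebotarev-separating-twists.md` for the line card.

Lead reshape (same composition idea, stubs_max = 7):
* old stub A `stub_separatingTwists` is now the PROVED lemma `separatingTwists_of_stubs`, obtained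
  from two new stubs: `stub_rayClassTwist` (pure algebraic number theory: a Kummer–Chebotarev /
  Thaine prime `𝔮` and a ray class character `ψ mod 𝔮` of odd prime exponent `p` with
  `ψ(τ • w) ≠ ψ(w)` on the batch; tree: `NumberFields.ThainePrimes.exists_prime_classGroup_kummer`,
  `LFunctions.AbelianFrobeniusDensity.isRayClassCharacter_toMulHom`) and `stub_avatarPowers`
  (class-field-theoretic dictionary: Artin avatars of `ψ^j`; tree:
  `HeckeCharacter.exists_of_isRayClassCharacter`, `HeckeCharacter.exists_framedArtinRep_of_isFiniteOrder`,
  Frobenius density for the exponent and parity clauses);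
* stub B `stub_admissiblePowers` now takes `hnti` (π not τ-invariant) instead of one place with
  `c (τ • w₀) ≠ c w₀`: the pigeonhole becomes Chebotarev-free (two non-robust exponents force
  `c w = c (τ • w)` and then `Sat(π, τ • w) = Sat(π, w)` at almost every `w`, contradicting `hnti`).
* stubs C–F unchanged.

Shape of the line (ARCH-II: batch supply of separating twists + cyclic unscrewing per batch +
finite-candidate gluing):
* `stub_rayClassTwist` + `stub_avatarPowers` ⟹ `separatingTwists_of_stubs` — THE LEVER: for every
  finite batch `T` of `τ`-moved places and every finite set `S` to avoid, twists unramified off a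
  finite `Q` disjoint from `S ∪ T ∪ τT`, trivial at complex conjugations, with `ψ(τw) ≠ ψ(w)` on `T`.
* `stub_admissiblePowers` — all but at most one power `ψ^j` (`0 < j < p`) is robustly
  non-`τ`-invariant on `π` (the admissibility clause of the controlled family); pigeonhole on
  `ψ^j` vs `ψ^{j'}` + `0 ∉ Sat(π,w)` + `p > n` + `hnti`.
* `stub_packageDictionary` — the induced package `R_ψ : Γ_{F₀} → GL_{2n}` of the family, restricted
  to `Γ_F`, has Frobenius roots `ψ̃(w)⁻¹•S_w + ψ̃(τw)⁻¹•S_{τw}` at every good place (`S_w` = roots of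
  `arithFrobPolyOfSatake`), is semisimple and `τ̃`-conjugation invariant (fibre `{w, τw}`, `Frob_w ↦
  Frob_v^{f}`, `expand`).
* `stub_cyclicUnscrewing` — THE ENGINE (hardest, held by the lead): from the packages of ONE
  prime-order twist and all but ≤ 1 of its powers, a semisimple `τ`-halving `ρ` of `A = C 0`
  matching `S_w` wherever the ratio `ψ(τw)/ψ(w) ≠ 1` (finite-order analogue of the tree's PROVED
  Harris–Lan–Taylor–Thorne Prop. 7.12, `TwistedSum.exists_framedRep_of_unbounded`: twist classes are
  free `ℤ/p`-torsors since `dim ≤ 2d < p`; generic exponent `k ∉ Bad(A)`, `|Bad(A)| ≤ 4d²`,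
  `p > 16d²`; support decomposition `C'_k = U ⊕ U''`, `A ≅ U ⊕ U''ν^{-k}` from the `(k,k)`
  Brauer–Nesbitt identity, `U''ν^{-k} ≅ U^θ`; roots/dimension by the mass argument `≤ 3d < p`).
* `stub_finiteCandidateGluing` — `τ`-halvings of `A` matching on every finite batch ⇒ one matching on
  all good split places (finitely many candidate halves up to isomorphism).
* `stub_assembly` — a `τ`-halving matching at the good split places satisfies the crux conclusion
  (inert places by `Negative.inert_halving`, unramifiedness of summands, cofiniteness, uniqueness of
  Satake parameters).
-/

open Literature.NumberTheory.GaloisRepresentations Literature.NumberTheory.Automorphic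
open IsDedekindDomain NumberField Filter

set_option linter.dupNamespace false

namespace Summit.Langlands.Langlands.Cruxes.TwistUnpackaging.KummerChebotarevSeparatingTwists

open Summit.Langlands.Langlands.Theorems.TwistUnpackaging.KummerChebotarev

/-! ## The stubs (six LANDED under `Theorems/QuadraticWindowTwistUnpackaging*.lean`, imported; one open: the engine) -/

/-- **Stub D — one-generator unscrewing with `τ`-halving (THE ENGINE; hardest stub).**  `F/F₀`
quadratic Galois, `t ∈ Γ_{F₀}` lifting `τ`, `θ = absGaloisOuterConj F₀ F t`; `e₁` a rank-one Artin
avatar of exponent `p` (`p` prime, `p > 16 d²`) with Frobenius value `c w` at every `w` outside a finite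
`τ`-stable `E`, and NON-TRIVIAL ratio `c (τ • w₀) ≠ c w₀` somewhere (repair of the junk instance
`ν = 1` of `CyclicTwistUnscrewing`, TRIAGE-r1-3 §2′: without it an irreducible `C 0` refutes the
splitting clause); `S w` (`w ∉ E`) `d`-element multisets of non-zero `ℓ`-adic numbers; `C j`
(`j ∈ J`, `0 ∈ J ⊇` all but at most one exponent `< p`) continuous semisimple
`Γ_F → GL_{2d}(ℚ̄_ℓ)` with `charpoly (C 0) ∘ θ = charpoly (C 0)` and characteristic roots
`ι⁻¹(c_w^j)⁻¹ • S_w + ι⁻¹(c_{τw}^j)⁻¹ • S_{τw}` at every arithmetic Frobenius at every `w ∉ E`.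
THEN there is a continuous semisimple `ρ : Γ_F → GL_d(ℚ̄_ℓ)` with
`charpoly (C 0) g = charpoly ρ g · charpoly ρ (θ g)` for all `g` (`C 0 ≅ ρ ⊕ ρ^τ`) whose Frobenius
roots are `S_w` at every `w ∉ E` where the ratio `c (τ • w)/c w ≠ 1`.
Intended proof (planner-verified route, TRIAGE-r1-2 App. B generalised): `μ := det (lAdicAvatar e₁ ι)`
(Frobenius value `ι⁻¹(c_w)⁻¹`), `C'_j := C j ⊗ μ^{-j}`, `ν := μ^θ/μ` (order `p`, `ν^θ = ν⁻¹` because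
`θ² = θ_{t²}` is inner); Chebotarev (`frobenius_dense`, `E` finite) + Brauer–Nesbitt give the
identities `C'_i ⊕ C'_j ν^i ≅ A ν^i ⊕ C'_{i+j}` (`A = C 0`), `C'_i ≤ A ⊕ A ν^i`, `C'_i^θ ≅ C'_i ν^{-i}`;
`Bad(A) := {χ ∈ ⟨ν⟩ : Hom(A ⊗ χ, A) ≠ 0}` has `≤ 4d²` elements (a self-twist `σ ≅ σ ⊗ ν^i` forces
`p ∣ dim σ ≤ 2d`), so some `k` has `±k, ±2k ∈ J` and `ν^{±k}, ν^{±2k} ∉ Bad(A)` (`p > 8d² + 6`); then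
`C'_k = U ⊕ U^θ ν^k` uniquely and the `ν^k`-layer of the `(k,k)` identity reads `A ≅ U ⊕ U^θ`: take
`ρ := U`; matching where `ν(σ) ≠ 1` by `Negative.separates_of` (`orderOf ν(σ)^k = p > d`).
Alternative: the ℤ/p unscrewing of crux idea `prime-order-cyclic-unscrewing` for `ρ₁ ⊕ ρ₂`, then
`ρ₂ ≅ ρ₁^θ` because `[ρ₂] - [ρ₁^θ]` is a `ν`-stable virtual class of mass `< p` on each sign. -/
theorem stub_cyclicUnscrewing :
    ∀ (F₀ F : Type) [Field F₀] [NumberField F₀] [Field F] [NumberField F] [Algebra F₀ F]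
      [IsGalois F₀ F] (τ : F ≃ₐ[F₀] F), Module.finrank F₀ F = 2 → τ ≠ 1 →
    ∀ (t : Field.absoluteGaloisGroup F₀), absGaloisQuot F₀ F t = τ →
    ∀ (ℓ : ℕ) [Fact ℓ.Prime] (ι : PadicAlgCl ℓ ≃+* ℂ) (d p : ℕ), p.Prime → 16 * d ^ 2 < p →
    ∀ (e₁ : FramedGaloisRep F ℂ 1) (c : HeightOneSpectrum (𝓞 F) → ℂ)
      (E : Set (HeightOneSpectrum (𝓞 F))) (S : HeightOneSpectrum (𝓞 F) → Multiset (PadicAlgCl ℓ))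
      (J : Set ℕ) (C : ℕ → FramedGaloisRep F (PadicAlgCl ℓ) (2 * d)),
      E.Finite → (∀ w ∉ E, τ • w ∉ E) →
      (∀ g : Field.absoluteGaloisGroup F, (e₁ g) ^ p = 1) →
      (∀ w ∉ E, e₁.HasFrobCharpolyAt w (Polynomial.X - Polynomial.C (c w))) →
      (∃ w₀, w₀ ∉ E ∧ c (τ • w₀) ≠ c w₀) →
      (∀ w ∉ E, Multiset.card (S w) = d ∧ (0 : PadicAlgCl ℓ) ∉ S w) →
      0 ∈ J → (Set.Iio p \ J).Subsingleton →
      (∀ j ∈ J, (C j).toGaloisRep.IsSemisimple) →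
      (∀ g : Field.absoluteGaloisGroup F,
          FramedRep.charpoly (C 0) (absGaloisOuterConj F₀ F t g) = FramedRep.charpoly (C 0) g) →
      (∀ j ∈ J, ∀ w ∉ E, ∀ 𝔓 ∈ w.primesAbove, ∀ σ : Field.absoluteGaloisGroup F,
          IsArithFrobAt (𝓞 F) σ 𝔓 →
          (FramedRep.charpoly (C j) σ).roots =
            (S w).map (fun x ↦ x * (ι.symm (c w ^ j))⁻¹) +
            (S (τ • w)).map (fun x ↦ x * (ι.symm (c (τ • w) ^ j))⁻¹)) →
    ∃ ρ : FramedGaloisRep F (PadicAlgCl ℓ) d,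
      ρ.toGaloisRep.IsSemisimple ∧
      (∀ g : Field.absoluteGaloisGroup F, FramedRep.charpoly (C 0) g =
          FramedRep.charpoly ρ g * FramedRep.charpoly ρ (absGaloisOuterConj F₀ F t g)) ∧
      ∀ w ∉ E, ∀ 𝔓 ∈ w.primesAbove, ∀ σ : Field.absoluteGaloisGroup F, IsArithFrobAt (𝓞 F) σ 𝔓 →
        c (τ • w) ≠ c w → (FramedRep.charpoly ρ σ).roots = S w := by
  sorry


/-! ## The lever, assembled from stubs A1 + A2 (proved) -/

/-- **Separating twists** (the old stub A, now PROVED from `stub_rayClassTwist` and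
`stub_avatarPowers`).  For `F/F₀` quadratic with non-trivial automorphism `τ`, a finite set `S` of
places of `F` to avoid, a finite batch `T` of places with `τ • w ≠ w` and a bound `m`, there are a
prime `p > m`, a finite exceptional set `Q` (here `{𝔮}`) disjoint from `S`, from `T` and from
`τ • T`, a value function `c` (`c v = ψ(v)`, a `p`-th root of unity off `Q`) with `c (τ • w) ≠ c w`
for `w ∈ T`, and rank-one Artin avatars `e j : Γ_F → GL_1(ℂ)` of exponent `p`, trivial at every
complex conjugation, unramified off `Q` with arithmetic-Frobenius value `c v ^ j` at every `v ∉ Q`.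
[folklore] -/
theorem separatingTwists_of_stubs :
    ∀ (F₀ F : Type) [Field F₀] [NumberField F₀] [Field F] [NumberField F] [Algebra F₀ F]
      (τ : F ≃ₐ[F₀] F), Module.finrank F₀ F = 2 → τ ≠ 1 →
    ∀ (S : Set (HeightOneSpectrum (𝓞 F))) (T : Finset (HeightOneSpectrum (𝓞 F))) (m : ℕ),
      S.Finite → (∀ w ∈ T, τ • w ≠ w) →
    ∃ (p : ℕ) (Q : Set (HeightOneSpectrum (𝓞 F))) (c : HeightOneSpectrum (𝓞 F) → ℂ)
      (e : ℕ → FramedGaloisRep F ℂ 1),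
      p.Prime ∧ m < p ∧ Q.Finite ∧ (∀ v ∈ Q, v ∉ S) ∧ (∀ w ∈ T, w ∉ Q ∧ τ • w ∉ Q) ∧
      (∀ v ∉ Q, c v ^ p = 1) ∧ (∀ w ∈ T, c (τ • w) ≠ c w) ∧
      (∀ j : ℕ, ∀ g : Field.absoluteGaloisGroup F, (e j g) ^ p = 1) ∧
      (∀ (j : ℕ) (φ : F →+* ℝ) (cc : Field.absoluteGaloisGroup F),
          IsComplexConjugation φ cc → e j cc = 1) ∧
      (∀ j : ℕ, ∀ v ∉ Q, (e j).IsUnramifiedAt v ∧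
          (e j).HasFrobCharpolyAt v (Polynomial.X - Polynomial.C (c v ^ j))) := by
  intro F₀ F _ _ _ _ _ τ hdeg hτ S T m hS hT
  obtain ⟨p, 𝔮, ψ, hp, hmp, h2p, hray, h𝔮S, h𝔮T, hψp, hψT⟩ :=
    stub_rayClassTwist F₀ F τ hdeg hτ S T m hS hT
  obtain ⟨e, hep, hecc, heF⟩ := stub_avatarPowers F 𝔮 ψ p hp h2p hray hψp
  refine ⟨p, {𝔮}, ψ, e, hp, hmp, Set.finite_singleton 𝔮, ?_, ?_, ?_, hψT, hep, hecc, ?_⟩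
  · intro v hv
    rw [Set.mem_singleton_iff] at hv
    subst hv
    exact h𝔮S
  · intro w hw
    simp only [Set.mem_singleton_iff]
    exact h𝔮T w hw
  · intro v hv
    exact hψp v hv
  · intro j v hv
    exact heF j v hv

/-! ## Two bookkeeping lemmas used by the composition (proved) -/

/-- `F/F₀` is unramified at all but finitely many places (Dedekind: finitely many primes divide the
different). Copy of `Literature.NumberTheory.Automorphic.eventually_ramificationIdx_eq_one` (kept local to
keep the import closure small). [folklore] -/
theorem eventually_ramificationIdx_eq_one' (F₀ F : Type) [Field F₀] [NumberField F₀] [Field F]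
    [NumberField F] [Algebra F₀ F] :
    ∀ᶠ w : HeightOneSpectrum (𝓞 F) in cofinite, w.asIdeal.ramificationIdx (𝓞 F₀) = 1 := by
  have h0 : differentIdeal (𝓞 F₀) (𝓞 F) ≠ ⊥ := differentIdeal_ne_bot
  refine (Ideal.finite_factors h0).subset fun w hw => ?_
  by_contra hnd
  apply hw
  haveI : Algebra.IsUnramifiedAt (𝓞 F₀) w.asIdeal := not_dvd_differentIdeal_iff.mp hnd
  exact Ideal.ramificationIdx_eq_one_of_isUnramifiedAt

/-- From "almost every place of `F`" to "almost every place of `F`, every place over the same place of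
`F₀`" (finite fibres of `w ↦ w ∩ 𝓞 F₀`). [folklore] -/
theorem eventually_forall_over_under {F₀ F : Type} [Field F₀] [NumberField F₀] [Field F]
    [NumberField F] [Algebra F₀ F] {P : HeightOneSpectrum (𝓞 F) → Prop}
    (h : ∀ᶠ w in cofinite, P w) :
    ∀ᶠ w : HeightOneSpectrum (𝓞 F) in cofinite,
      ∀ w' : HeightOneSpectrum (𝓞 F), w'.under (𝓞 F₀) = w.under (𝓞 F₀) → P w' := by
  have h1 : ∀ᶠ v : HeightOneSpectrum (𝓞 F₀) in cofinite,
      ∀ w' : HeightOneSpectrum (𝓞 F), w'.under (𝓞 F₀) = v → P w' := by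
    rw [Filter.eventually_cofinite] at h ⊢
    refine (h.image (fun w' : HeightOneSpectrum (𝓞 F) => w'.under (𝓞 F₀))).subset ?_
    intro v hv
    simp only [Set.mem_setOf_eq, not_forall, exists_prop] at hv
    obtain ⟨w', hw', hp⟩ := hv
    exact ⟨w', hp, hw'⟩
  exact (HeightOneSpectrum.tendsto_under_cofinite (𝓞 F₀) (B := 𝓞 F)).eventually h1

/-! ## The composition: the seven stubs imply the crux, by name -/

set_option maxHeartbeats 1600000 in
/-- **The line concludes the crux.** `stub_rayClassTwist → stub_avatarPowers → stub_admissiblePowers →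
stub_packageDictionary → stub_cyclicUnscrewing → stub_finiteCandidateGluing → stub_assembly →
TwistUnpackaging`, kernel-checked (the only `sorry`s are inside the seven stubs). The hypotheses
`hTR, e, k, hreg, hpol, hpar, hodd, hℓ, hunr` of the crux are not used (Core form, cdisprove §2). -/
theorem TwistUnpackaging_of : Summit.Langlands.Langlands.Theses.QuadraticWindow.TwistUnpackaging := by
  intro F₀ F _ _ _ _ _ τ hTR hdeg hτ n hcpt π e k hreg hpol hpar hodd hnti ℓ _ ι hℓ hunr hfam
  classical
  /- 1. `F/F₀` is Galois with group `{1, τ}`; a lift `t ∈ Γ_{F₀}` of `τ`. -/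
  haveI : FiniteDimensional F₀ F := Module.finite_of_finrank_eq_succ hdeg
  have hcard : Fintype.card (F ≃ₐ[F₀] F) = 2 := by
    apply le_antisymm (hdeg ▸ AlgEquiv.card_le)
    haveI : Nontrivial (F ≃ₐ[F₀] F) := ⟨⟨τ, 1, hτ⟩⟩
    exact Fintype.one_lt_card
  haveI hGal : IsGalois F₀ F :=
    IsGalois.of_card_aut_eq_finrank F₀ F (by rw [Nat.card_eq_fintype_card, hcard, hdeg])
  have hττ : ∀ w : HeightOneSpectrum (𝓞 F), τ • τ • w = w := by
    have h2 : τ * τ = 1 := by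
      have h := pow_card_eq_one (G := F ≃ₐ[F₀] F) (x := τ)
      rwa [hcard, pow_two] at h
    intro w
    rw [← mul_smul, h2, one_smul]
  obtain ⟨t, ht⟩ := absGaloisQuot_surjective F₀ F τ
  /- 2. A Satake choice function. -/
  let αf : HeightOneSpectrum (𝓞 F) → Multiset ℂ := fun w =>
    if h : ∃ α, π.1.HasSatakeParamAt w α then h.choose else 0
  have hαf : ∀ w α, π.1.HasSatakeParamAt w α → π.1.HasSatakeParamAt w (αf w) := by
    intro w α h
    have hex : ∃ α, π.1.HasSatakeParamAt w α := ⟨α, h⟩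
    simp only [αf, dif_pos hex]
    exact hex.choose_spec
  have hαu : ∀ w α, π.1.HasSatakeParamAt w α → α = αf w := fun w α h =>
    π.1.hasSatakeParamAt_unique_holds h (hαf w α h)
  /- 3. The places above `ℓ`; the twist-free member of the family (stub A with the empty batch). -/
  set Sℓ : Set (HeightOneSpectrum (𝓞 F)) := {w | ((ℓ : ℕ) : 𝓞 F) ∈ w.asIdeal} with hSℓ_def
  have hSℓ : Sℓ.Finite := by
    have hne : (Ideal.span {((ℓ : ℕ) : 𝓞 F)} : Ideal (𝓞 F)) ≠ ⊥ := by
      rw [Ne, Ideal.span_singleton_eq_bot]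
      exact_mod_cast (Fact.out : ℓ.Prime).ne_zero
    refine (Ideal.finite_factors hne).subset fun w hw => ?_
    show w.asIdeal ∣ Ideal.span {((ℓ : ℕ) : 𝓞 F)}
    rw [Ideal.dvd_span_singleton]
    exact hw
  obtain ⟨p₀, Q₀, c₀, e₀, hp₀, -, hQ₀, hQ₀S, -, hc₀, -, he₀p, he₀cc, he₀F⟩ :=
    separatingTwists_of_stubs F₀ F τ hdeg hτ Sℓ ∅ 0 hSℓ (by simp)
  /- 4. The good places `G` (cofinite, `τ`-stable) and a good split place `wstar`. -/
  set G : Set (HeightOneSpectrum (𝓞 F)) := {w |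
      ((ℓ : ℕ) : 𝓞 F₀) ∉ (w.under (𝓞 F₀)).asIdeal ∧
      (∀ w' : HeightOneSpectrum (𝓞 F), w'.under (𝓞 F₀) = w.under (𝓞 F₀) →
          w'.asIdeal.ramificationIdx (𝓞 F₀) = 1 ∧ π.1.HasSatakeParamAt w' (αf w')) ∧
      w ∉ Q₀ ∧ τ • w ∉ Q₀} with hG_def
  have hG : ∀ᶠ w in cofinite, w ∈ G := by
    have h1 : ∀ᶠ w : HeightOneSpectrum (𝓞 F) in cofinite,
        ((ℓ : ℕ) : 𝓞 F₀) ∉ (w.under (𝓞 F₀)).asIdeal := by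
      have hfin : {v : HeightOneSpectrum (𝓞 F₀) | ((ℓ : ℕ) : 𝓞 F₀) ∈ v.asIdeal}.Finite := by
        have hne : (Ideal.span {((ℓ : ℕ) : 𝓞 F₀)} : Ideal (𝓞 F₀)) ≠ ⊥ := by
          rw [Ne, Ideal.span_singleton_eq_bot]
          exact_mod_cast (Fact.out : ℓ.Prime).ne_zero
        refine (Ideal.finite_factors hne).subset fun v hv => ?_
        show v.asIdeal ∣ Ideal.span {((ℓ : ℕ) : 𝓞 F₀)}
        rw [Ideal.dvd_span_singleton]
        exact hv
      have h : ∀ᶠ v : HeightOneSpectrum (𝓞 F₀) in cofinite, ((ℓ : ℕ) : 𝓞 F₀) ∉ v.asIdeal := by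
        rw [Filter.eventually_cofinite]
        simpa only [not_not] using hfin
      exact (HeightOneSpectrum.tendsto_under_cofinite (𝓞 F₀) (B := 𝓞 F)).eventually h
    have h2 : ∀ᶠ w : HeightOneSpectrum (𝓞 F) in cofinite, ∀ w' : HeightOneSpectrum (𝓞 F),
        w'.under (𝓞 F₀) = w.under (𝓞 F₀) →
          w'.asIdeal.ramificationIdx (𝓞 F₀) = 1 ∧ π.1.HasSatakeParamAt w' (αf w') := by
      apply eventually_forall_over_under
      filter_upwards [eventually_ramificationIdx_eq_one' F₀ F,
        (π.1.hasSatakeParamAt_cofinite_holds : ∀ᶠ v in cofinite, π.1.IsUnramifiedAt v)] with w h1 h2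
      obtain ⟨α, hα⟩ := h2
      exact ⟨h1, hαf w α hα⟩
    have h3 : ∀ᶠ w : HeightOneSpectrum (𝓞 F) in cofinite, w ∉ Q₀ := hQ₀.compl_mem_cofinite
    have h4 : ∀ᶠ w : HeightOneSpectrum (𝓞 F) in cofinite, τ • w ∉ Q₀ :=
      (Function.Injective.tendsto_cofinite (MulAction.injective τ)).eventually h3
    filter_upwards [h1, h2, h3, h4] with w a b c d
    exact ⟨a, b, c, d⟩
  have hGτ : ∀ w ∈ G, τ • w ∈ G := by
    intro w hw
    refine ⟨?_, ?_, hw.2.2.2, ?_⟩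
    · rw [HeightOneSpectrum.under_algEquiv_smul]
      exact hw.1
    · intro w' hw'
      rw [HeightOneSpectrum.under_algEquiv_smul] at hw'
      exact hw.2.1 w' hw'
    · rw [hττ]
      exact hw.2.2.1
  obtain ⟨wstar, hwstarG, hwstar⟩ : ∃ wstar ∈ G, τ • wstar ≠ wstar := by
    obtain ⟨w, ⟨α, β, hα, hβ, hne⟩, hwG⟩ := (hnti.and_eventually hG).exists
    refine ⟨w, hwG, fun heq => hne ?_⟩
    rw [heq] at hβ
    rw [hαu w β hβ, hαu w α hα]
  /- 5. The `ψ = 1` package `A = R₀|_{Γ_F}` (admissibility of `e₀ 0` from `hnti`) and its data. -/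
  have hadm0₁ : ∀ w : HeightOneSpectrum (𝓞 F), ((ℓ : ℕ) : 𝓞 F) ∈ w.asIdeal →
      (e₀ 0).IsUnramifiedAt w :=
    fun w hw => (he₀F 0 w (fun hQ => hQ₀S w hQ hw)).1
  have hadm0₂ : ∀ (φ : F →+* ℝ) (cc cc' : Field.absoluteGaloisGroup F), IsComplexConjugation φ cc →
      IsComplexConjugation (φ.comp (τ : F →+* F)) cc' →
      Matrix.GeneralLinearGroup.det ((e₀ 0) cc) = Matrix.GeneralLinearGroup.det ((e₀ 0) cc') := by
    intro φ cc cc' h1 h2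
    rw [he₀cc 0 φ cc h1, he₀cc 0 _ cc' h2]
  have hadm0₃ : ∃ᶠ w in Filter.cofinite, ∃ (α β : Multiset ℂ) (a a' : ℂ),
      π.1.HasSatakeParamAt w α ∧ π.1.HasSatakeParamAt (τ • w) β ∧
      (e₀ 0).HasFrobCharpolyAt w (Polynomial.X - Polynomial.C a) ∧
      (e₀ 0).HasFrobCharpolyAt (τ • w) (Polynomial.X - Polynomial.C a') ∧
      β.map (fun b ↦ b * a') ≠ α.map (fun x ↦ x * a) := by
    refine (hnti.and_eventually hG).mono ?_
    rintro w ⟨⟨α, β, hα, hβ, hne⟩, hwG⟩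
    refine ⟨α, β, c₀ w ^ 0, c₀ (τ • w) ^ 0, hα, hβ, (he₀F 0 w hwG.2.2.1).2,
      (he₀F 0 (τ • w) hwG.2.2.2).2, ?_⟩
    simpa using hne
  obtain ⟨R₀, hR₀ss, hR₀⟩ := hfam (e₀ 0) hadm0₁ hadm0₂ hadm0₃
  obtain ⟨hAss, hAτ, hAw⟩ := stub_packageDictionary F₀ F τ hdeg hτ n hcpt π ℓ ι (e₀ 0)
    (fun v => c₀ v ^ 0) Q₀ αf R₀ (fun v hv => he₀F 0 v hv) hR₀ss hR₀
  have hAdata : ∀ w ∈ G, (R₀.restrictField F).IsUnramifiedAt w ∧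
      Multiset.card (arithFrobPolyOfSatake ι w.residueCard n (αf w)).roots = n ∧
      (0 : PadicAlgCl ℓ) ∉ (arithFrobPolyOfSatake ι w.residueCard n (αf w)).roots ∧
      ∀ 𝔓 ∈ w.primesAbove, ∀ σ : Field.absoluteGaloisGroup F, IsArithFrobAt (𝓞 F) σ 𝔓 →
        (FramedRep.charpoly (R₀.restrictField F) σ).roots =
          (arithFrobPolyOfSatake ι w.residueCard n (αf w)).roots +
          (arithFrobPolyOfSatake ι (τ • w).residueCard n (αf (τ • w))).roots := by
    intro w hw
    obtain ⟨h1, h2, h3, h4⟩ := hAw w hw.1 hw.2.1 hw.2.2.1 hw.2.2.2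
    refine ⟨h1, h2, h3, fun 𝔓 h𝔓 σ hσ => ?_⟩
    have h5 := h4 𝔓 h𝔓 σ hσ
    simp only [pow_zero, map_one, inv_one, mul_one, Multiset.map_id'] at h5
    exact h5
  /- 6. Per finite batch of good split places: twists (A) ⇒ admissible powers (B) ⇒ packages
        (hfam) ⇒ dictionary (C) ⇒ a `τ`-halving of `A = R₀|_{Γ_F}` matching on the batch (D). -/
  set Gs : Set (HeightOneSpectrum (𝓞 F)) := {w | w ∈ G ∧ τ • w ≠ w} with hGs_def
  have batch : ∀ T : Finset (HeightOneSpectrum (𝓞 F)), (↑T : Set (HeightOneSpectrum (𝓞 F))) ⊆ Gs →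
      ∃ ρ : FramedGaloisRep F (PadicAlgCl ℓ) n, ρ.toGaloisRep.IsSemisimple ∧
        (∀ g : Field.absoluteGaloisGroup F, FramedRep.charpoly (R₀.restrictField F) g =
            FramedRep.charpoly ρ g * FramedRep.charpoly ρ (absGaloisOuterConj F₀ F t g)) ∧
        ∀ w ∈ T, ∀ 𝔓 ∈ w.primesAbove, ∀ σ : Field.absoluteGaloisGroup F,
          IsArithFrobAt (𝓞 F) σ 𝔓 →
            (FramedRep.charpoly ρ σ).roots = (arithFrobPolyOfSatake ι w.residueCard n (αf w)).roots := by
    intro T hT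
    -- enlarge the batch by the good split place `wstar`
    set T' : Finset (HeightOneSpectrum (𝓞 F)) := insert wstar T with hT'_def
    have hT' : ∀ w ∈ T', w ∈ G ∧ τ • w ≠ w := by
      intro w hw
      rcases Finset.mem_insert.mp hw with rfl | hw
      · exact ⟨hwstarG, hwstar⟩
      · exact hT (Finset.mem_coe.mpr hw)
    have hwT' : wstar ∈ T' := Finset.mem_insert_self _ _
    -- (A) separating twists for the batch
    obtain ⟨p, Q, c, eT, hp, hmp, hQ, hQS, hQT, hcp, hcT, hep, hecc, heF⟩ :=
      separatingTwists_of_stubs F₀ F τ hdeg hτ Sℓ T' (16 * n ^ 2 + n) hSℓ (fun w hw => (hT' w hw).2)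
    have hnp : n < p := lt_of_le_of_lt (Nat.le_add_left n (16 * n ^ 2)) hmp
    have h16 : 16 * n ^ 2 < p := lt_of_le_of_lt (Nat.le_add_right (16 * n ^ 2) n) hmp
    -- the exceptional set of the batch
    set E : Set (HeightOneSpectrum (𝓞 F)) := {w | w ∉ G ∨ w ∈ Q ∨ τ • w ∈ Q} with hE_def
    have hmemE : ∀ w, w ∉ E ↔ (w ∈ G ∧ w ∉ Q ∧ τ • w ∉ Q) := by
      intro w
      simp only [hE_def, Set.mem_setOf_eq, not_or, not_not]
    have hEfin : E.Finite := by
      have h1 : {w : HeightOneSpectrum (𝓞 F) | ¬ w ∈ G}.Finite := by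
        rwa [Filter.eventually_cofinite] at hG
      have h3 : {w : HeightOneSpectrum (𝓞 F) | τ • w ∈ Q}.Finite :=
        hQ.preimage (MulAction.injective τ).injOn
      exact (h1.union (hQ.union h3)).subset fun w hw => hw
    have hEτ : ∀ w ∉ E, τ • w ∉ E := by
      intro w hw
      rw [hmemE] at hw ⊢
      refine ⟨hGτ w hw.1, hw.2.2, ?_⟩
      rw [hττ]
      exact hw.2.1
    have hw0E : wstar ∉ E := (hmemE _).2 ⟨hwstarG, (hQT _ hwT').1, (hQT _ hwT').2⟩
    -- (B) admissible exponents
    obtain ⟨j₀, hj₀⟩ := stub_admissiblePowers F₀ F τ n hcpt π p Q c eT hp hnp hQ hcp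
      (fun j v hv => (heF j v hv).2) hnti
    have hadm₁ : ∀ j : ℕ, ∀ w : HeightOneSpectrum (𝓞 F), ((ℓ : ℕ) : 𝓞 F) ∈ w.asIdeal →
        (eT j).IsUnramifiedAt w :=
      fun j w hw => (heF j w (fun hQ' => hQS w hQ' hw)).1
    have hadm₂ : ∀ (j : ℕ) (φ : F →+* ℝ) (cc cc' : Field.absoluteGaloisGroup F),
        IsComplexConjugation φ cc → IsComplexConjugation (φ.comp (τ : F →+* F)) cc' →
        Matrix.GeneralLinearGroup.det ((eT j) cc) = Matrix.GeneralLinearGroup.det ((eT j) cc') := by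
      intro j φ cc cc' h1 h2
      rw [hecc j φ cc h1, hecc j _ cc' h2]
    -- the packages of the admissible powers (hfam) and the family `Cfam`
    have hpkg := fun (j : ℕ) (h : 0 < j ∧ j < p ∧ j ≠ j₀) =>
      hfam (eT j) (hadm₁ j) (hadm₂ j) (hj₀ j h.1 h.2.1 h.2.2)
    choose Rj hRjss hRj using hpkg
    set Cfam : ℕ → FramedGaloisRep F (PadicAlgCl ℓ) (2 * n) := fun j =>
      if h : 0 < j ∧ j < p ∧ j ≠ j₀ then (Rj j h).restrictField F else (R₀.restrictField F) with hCfam_def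
    have hC0 : Cfam 0 = (R₀.restrictField F) := by
      simp [hCfam_def]
    have hCj : ∀ (j : ℕ) (h : 0 < j ∧ j < p ∧ j ≠ j₀), Cfam j = (Rj j h).restrictField F := by
      intro j h
      simp only [hCfam_def, dif_pos h]
    set J : Set ℕ := {j | j = 0 ∨ (0 < j ∧ j < p ∧ j ≠ j₀)} with hJ_def
    have hJ0 : (0 : ℕ) ∈ J := Or.inl rfl
    have hJsub : (Set.Iio p \ J).Subsingleton := by
      intro a ha b hb
      simp only [hJ_def, Set.mem_sdiff, Set.mem_Iio, Set.mem_setOf_eq] at ha hb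
      omega
    have hss : ∀ j ∈ J, (Cfam j).toGaloisRep.IsSemisimple := by
      intro j hj
      rcases hj with rfl | h
      · rw [hC0]
        exact hAss
      · rw [hCj j h]
        exact (stub_packageDictionary F₀ F τ hdeg hτ n hcpt π ℓ ι (eT j) (fun v => c v ^ j) Q αf
          (Rj j h) (fun v hv => heF j v hv) (hRjss j h) (hRj j h)).1
    have hAθ : ∀ g : Field.absoluteGaloisGroup F,
        FramedRep.charpoly (Cfam 0) (absGaloisOuterConj F₀ F t g) = FramedRep.charpoly (Cfam 0) g := by
      intro g
      rw [hC0]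
      exact hAτ t g
    have hCdata : ∀ j ∈ J, ∀ w ∉ E, ∀ 𝔓 ∈ w.primesAbove, ∀ σ : Field.absoluteGaloisGroup F,
        IsArithFrobAt (𝓞 F) σ 𝔓 → (FramedRep.charpoly (Cfam j) σ).roots =
          (arithFrobPolyOfSatake ι w.residueCard n (αf w)).roots.map
              (fun x ↦ x * (ι.symm (c w ^ j))⁻¹) +
          (arithFrobPolyOfSatake ι (τ • w).residueCard n (αf (τ • w))).roots.map
              (fun x ↦ x * (ι.symm (c (τ • w) ^ j))⁻¹) := by
      intro j hj w hw 𝔓 h𝔓 σ hσ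
      obtain ⟨hwG, hwQ, hτwQ⟩ := (hmemE w).1 hw
      rcases hj with rfl | h
      · simp only [pow_zero, map_one, inv_one, mul_one, Multiset.map_id', hC0]
        exact (hAdata w hwG).2.2.2 𝔓 h𝔓 σ hσ
      · rw [hCj j h]
        exact ((stub_packageDictionary F₀ F τ hdeg hτ n hcpt π ℓ ι (eT j) (fun v => c v ^ j) Q αf
          (Rj j h) (fun v hv => heF j v hv) (hRjss j h) (hRj j h)).2.2 w hwG.1 hwG.2.1 hwQ
            hτwQ).2.2.2 𝔓 h𝔓 σ hσ
    have he1F : ∀ w ∉ E, (eT 1).HasFrobCharpolyAt w (Polynomial.X - Polynomial.C (c w)) := by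
      intro w hw
      have h := (heF 1 w ((hmemE w).1 hw).2.1).2
      rwa [pow_one] at h
    have hS : ∀ w ∉ E, Multiset.card (arithFrobPolyOfSatake ι w.residueCard n (αf w)).roots = n ∧
        (0 : PadicAlgCl ℓ) ∉ (arithFrobPolyOfSatake ι w.residueCard n (αf w)).roots :=
      fun w hw => ⟨(hAdata w ((hmemE w).1 hw).1).2.1, (hAdata w ((hmemE w).1 hw).1).2.2.1⟩
    -- (D) the engine
    obtain ⟨ρT, hρTss, hρTsplit, hρTmatch⟩ := stub_cyclicUnscrewing F₀ F τ hdeg hτ t ht ℓ ι n p hp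
      h16 (eT 1) c E (fun w => (arithFrobPolyOfSatake ι w.residueCard n (αf w)).roots) J Cfam hEfin
      hEτ (hep 1) he1F ⟨wstar, hw0E, hcT _ hwT'⟩ hS hJ0 hJsub hss hAθ hCdata
    refine ⟨ρT, hρTss, fun g => ?_, fun w hw 𝔓 h𝔓 σ hσ => ?_⟩
    · rw [← hC0]
      exact hρTsplit g
    · have hw' : w ∈ T' := Finset.mem_insert_of_mem hw
      exact hρTmatch w ((hmemE w).2 ⟨(hT' w hw').1, (hQT w hw').1, (hQT w hw').2⟩) 𝔓 h𝔓 σ hσ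
        (hcT w hw')
  /- 7. Glue the batch halvings (E) and assemble the crux conclusion (F). -/
  obtain ⟨ρ, hρss, hρsplit, hρmatch⟩ := stub_finiteCandidateGluing F₀ F t ℓ n
    (R₀.restrictField F) hAss Gs (fun w => (arithFrobPolyOfSatake ι w.residueCard n (αf w)).roots) batch
  refine ⟨ρ, hρss, ?_⟩
  exact stub_assembly F₀ F τ hdeg hτ t ht n hcpt π ℓ ι αf G (R₀.restrictField F) ρ hG
    (fun w hw => ⟨hGτ w hw, (hw.2.1 w rfl).2⟩)
    (fun w hw => ⟨(hAdata w hw).1, (hAdata w hw).2.2.2⟩) hAss hρss hρsplit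
    (fun w hw hτw => hρmatch w ⟨hw, hτw⟩)

end Summit.Langlands.Langlands.Cruxes.TwistUnpackaging.KummerChebotarevSeparatingTwists
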